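import Summits.QuantumFields.YangMills.Theorems.IR.Negative.TypOnsetFloorPoly.Markov

/-!
# Crux `IR` (stmt-QuantumFields-19354) — the POLYNOMIAL ROW FLOOR `b⋆_T(β) ≥ c·(β / log β)^{1/7}` for EVERY compact gauge group,
# part 6/10: §4h Cauchy–Schwarz + Jensen: K1′ from the kernel mean of the film plaquette ENERGY (section `PlaqEnergy`)

Re-homed VERBATIM (statements, proofs, names; namespace `…Cruxes.IR.CruxIdea2g7` ↦ `…Cruxes.IR.RowFloorPoly`) from the crux
workfile `Cruxes/IR/CruxIdea2RowFloorPoly.lean` rev 14 (sha16 742d7312ea0b5c70; author `ym-cruxidea-19354-2` GEN 7; kernel certificate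
`Cruxes/IR/CruxIdea2RowFloorPolyCert.lean` rev 1, sha16 59d3cfe64fab9c7c, gate-elaborated stub-free) per owner R114 (2) (landing seat:
the `ym-19354-disprove-1` lineage, g9), split by its sections into ten ≤ 400-line modules chained by import; the module docstring of
record (history, theorem map, honest framing) is in the headline module `Theorems/IR/Negative/TypOnsetFloorPoly.lean` (part 10/10).
Negative knowledge for stmt-QuantumFields-19354 (`--supports`; closes no stub); not mixing, not a mass gap, nothing about Clay.
-/

set_option autoImplicit false

noncomputable section

open MeasureTheory Filter Topology
open Literature.MathematicalPhysics.QuantumLattice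
open Literature.Probability.LatticeModels
open Summit.QuantumFields.YangMills.Cruxes.IR.Tempered (cellEdges windowCells regionEdges)
open Summit.QuantumFields.YangMills.Cruxes.IR.ShellTempered (windowCellsPlus)
open Summit.QuantumFields.YangMills.Cruxes.IR.OnsetFormats (TypShellCond shellCount)
open Summit.QuantumFields.YangMills.Cruxes.IR.FixedMesh
open Summit.QuantumFields.YangMills.Cruxes.IR.FixedMeshAllG
open Summit.QuantumFields.YangMills.Theorems.FemtoCurvatureTwoPoint.DoublingOfRV (norm_rho_mul_sub_one_le norm_rho_inv_sub_one)
open Summit.QuantumFields.YangMills.Cruxes.IR.HairpinStokes (norm_map_conj_sub_one sub_re_trace_eq_norm_sq)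
open Literature.MathematicalPhysics.QuantumFieldTheory (abs_re_trace_le_sqrt_mul re_trace_map_inv)

namespace Summit.QuantumFields.YangMills.Cruxes.IR.RowFloorPoly

/-! ## §4h (PROVED) Cauchy–Schwarz + Jensen: K1′ reduces to the kernel mean of the film's plaquette ENERGY (K1″, linear in plaquettes) -/

section PlaqEnergy

open scoped Matrix Matrix.Norms.Frobenius
open Literature.MathematicalPhysics.QuantumFieldTheory (wilsonMeasure GaugeConfig isProbabilityMeasure_wilsonMeasure)
open Summit.QuantumFields.YangMills.Theorems.TunedSequenceExists.Negative.Freezing (integrable_of_continuous)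

/-- **Jensen for the square root (PROVED by AM–GM, no concavity API):** on a probability space, for `f ≥ 0` integrable,
`∫ √f ≤ √(∫ f)` (for every `t > 0`, `√f ≤ f/(2t) + t/2`; integrate; optimise `t = √(∫ f)`). -/
theorem integral_sqrt_le_sqrt_integral {X : Type*} [MeasurableSpace X] (μ : Measure X) [IsProbabilityMeasure μ]
    {f : X → ℝ} (hf : ∀ x, 0 ≤ f x) (hfi : Integrable f μ) :
    ∫ x, Real.sqrt (f x) ∂μ ≤ Real.sqrt (∫ x, f x ∂μ) := by
  set I := ∫ x, f x ∂μ with hI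
  have hamgm : ∀ t : ℝ, 0 < t → ∫ x, Real.sqrt (f x) ∂μ ≤ I / (2 * t) + t / 2 := by
    intro t ht
    have ht0 : t ≠ 0 := ht.ne'
    have hpt : ∀ x, Real.sqrt (f x) ≤ f x / (2 * t) + t / 2 := by
      intro x
      obtain ⟨s, hs0, hfx⟩ : ∃ s : ℝ, 0 ≤ s ∧ f x = s ^ 2 :=
        ⟨Real.sqrt (f x), Real.sqrt_nonneg _, (Real.sq_sqrt (hf x)).symm⟩
      rw [hfx, Real.sqrt_sq hs0]
      have hid : s ^ 2 / (2 * t) + t / 2 = s + (s - t) ^ 2 / (2 * t) := by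
        field_simp
        ring
      rw [hid]
      exact le_add_of_nonneg_right (div_nonneg (sq_nonneg _) (by positivity))
    have hint2 : Integrable (fun x => f x / (2 * t) + t / 2) μ := (hfi.div_const _).add (integrable_const _)
    calc ∫ x, Real.sqrt (f x) ∂μ ≤ ∫ x, (f x / (2 * t) + t / 2) ∂μ :=
          integral_mono_of_nonneg (ae_of_all _ fun x => Real.sqrt_nonneg _) hint2 (ae_of_all _ hpt)
      _ = I / (2 * t) + t / 2 := by
          rw [integral_add (hfi.div_const _) (integrable_const _), integral_div, integral_const, hI]
          simp
  by_cases hIpos : 0 < I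
  · set s := Real.sqrt I with hs
    have hs0 : 0 < s := Real.sqrt_pos.2 hIpos
    have hss : s * s = I := Real.mul_self_sqrt hIpos.le
    have h := hamgm s hs0
    have hid : I / (2 * s) + s / 2 = s := by
      rw [← hss]
      field_simp
      ring
    linarith [h, hid]
  · push Not at hIpos
    have hle : ∫ x, Real.sqrt (f x) ∂μ ≤ 0 := by
      by_contra hcon
      push Not at hcon
      have h := hamgm _ hcon
      have hdiv : I / (2 * ∫ x, Real.sqrt (f x) ∂μ) ≤ 0 :=
        div_nonpos_iff.2 (Or.inr ⟨hIpos, by positivity⟩)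
      linarith
    exact hle.trans (Real.sqrt_nonneg _)

variable {G : Type} [Group G] [TopologicalSpace G] [IsTopologicalGroup G] [CompactSpace G]
  [SecondCountableTopology G] [MeasurableSpace G] [BorelSpace G]
  {N : ℕ} (ρ : G →* Matrix (Fin N) (Fin N) ℂ)

/-- The total SQUARED Frobenius plaquette defect `Σ_{p∈Σ} ‖ρ(U_p) − 1‖²_F` of the spanning surface `Σ = [0,b] × [0,m)` —
the film's plaquette ENERGY on `Σ` (`= 2 Σ_p (N − Re tr ρ(U_p))`, `plaqDefectSqSum_eq_two_mul_sum_cost`). -/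
def plaqDefectSqSum (b m : ℕ) (U : LGConfig 4 G) : ℝ :=
  ∑ s ∈ Finset.range m, ∑ t ∈ Finset.range (b + 1), ‖ρ (plaq U t s) - 1‖ ^ 2

omit [TopologicalSpace G] [IsTopologicalGroup G] [CompactSpace G] [SecondCountableTopology G] [MeasurableSpace G]
  [BorelSpace G] in
/-- Energy = twice the plaquette cost: `Σ ‖ρ(U_p) − 1‖²_F = 2 Σ (N − Re tr ρ(U_p))` (unitary `ρ`). -/
theorem plaqDefectSqSum_eq_two_mul_sum_cost (hρu : ∀ g, ρ g ∈ Matrix.unitaryGroup (Fin N) ℂ) (b m : ℕ)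
    (U : LGConfig 4 G) : plaqDefectSqSum ρ b m U =
      2 * ∑ s ∈ Finset.range m, ∑ t ∈ Finset.range (b + 1), ((N : ℝ) - (ρ (plaq U t s)).trace.re) := by
  unfold plaqDefectSqSum
  rw [Finset.mul_sum]
  refine Finset.sum_congr rfl fun s _ => ?_
  rw [Finset.mul_sum]
  refine Finset.sum_congr rfl fun t _ => ?_
  rw [sub_re_trace_eq_norm_sq ρ hρu]
  ring

omit [CompactSpace G] [SecondCountableTopology G] [MeasurableSpace G] [BorelSpace G] in
/-- Helper lemma `continuous_plaqDefectSqSum` of the row-floor chain (re-homed verbatim from the crux workfile; see the module docstring). -/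
theorem continuous_plaqDefectSqSum (hρ : Continuous ρ) (b m : ℕ) : Continuous (plaqDefectSqSum ρ b m) := by
  unfold plaqDefectSqSum
  exact continuous_finsetSum _ fun s _ => continuous_finsetSum _ fun t _ =>
    (((hρ.comp (continuous_plaq _ _)).sub continuous_const).norm.pow 2)

omit [TopologicalSpace G] [IsTopologicalGroup G] [CompactSpace G] [SecondCountableTopology G] [MeasurableSpace G]
  [BorelSpace G] in
/-- Helper lemma `plaqDefectSqSum_nonneg` of the row-floor chain (re-homed verbatim from the crux workfile; see the module docstring). -/
theorem plaqDefectSqSum_nonneg (b m : ℕ) (U : LGConfig 4 G) : 0 ≤ plaqDefectSqSum ρ b m U :=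
  Finset.sum_nonneg fun _ _ => Finset.sum_nonneg fun _ _ => sq_nonneg _

omit [TopologicalSpace G] [IsTopologicalGroup G] [CompactSpace G] [SecondCountableTopology G] [MeasurableSpace G]
  [BorelSpace G] in
/-- Helper lemma `plaqDefectSqSum_le` of the row-floor chain (re-homed verbatim from the crux workfile; see the module docstring). -/
theorem plaqDefectSqSum_le (hρu : ∀ g, ρ g ∈ Matrix.unitaryGroup (Fin N) ℂ) (b m : ℕ) (U : LGConfig 4 G) :
    plaqDefectSqSum ρ b m U ≤ m * ((b + 1) * (2 * Real.sqrt N) ^ 2) := by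
  unfold plaqDefectSqSum
  have h1 : ∀ s ∈ Finset.range m, ∑ t ∈ Finset.range (b + 1), ‖ρ (plaq U t s) - 1‖ ^ 2 ≤
      (b + 1) * (2 * Real.sqrt N) ^ 2 := by
    intro s _
    have h := Finset.sum_le_card_nsmul (Finset.range (b + 1)) (fun t => ‖ρ (plaq U (t : ℤ) s) - 1‖ ^ 2)
      ((2 * Real.sqrt N) ^ 2) fun t _ => pow_le_pow_left₀ (norm_nonneg _) (norm_map_sub_one_le ρ hρu _) 2
    simpa [Finset.card_range, nsmul_eq_mul] using h
  have h2 := Finset.sum_le_card_nsmul (Finset.range m)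
    (fun s => ∑ t ∈ Finset.range (b + 1), ‖ρ (plaq U t s) - 1‖ ^ 2) ((b + 1) * (2 * Real.sqrt N) ^ 2) h1
  simpa [Finset.card_range, nsmul_eq_mul] using h2

omit [TopologicalSpace G] [IsTopologicalGroup G] [CompactSpace G] [SecondCountableTopology G] [MeasurableSpace G]
  [BorelSpace G] in
/-- **Cauchy–Schwarz over the surface (PROVED):** `(Σ_p ‖ρ(U_p) − 1‖)² ≤ #Σ · Σ_p ‖ρ(U_p) − 1‖²`. -/
theorem plaqDefectSum_sq_le (b m : ℕ) (U : LGConfig 4 G) :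
    plaqDefectSum ρ b m U ^ 2 ≤ ((b + 1 : ℕ) * m : ℝ) * plaqDefectSqSum ρ b m U := by
  unfold plaqDefectSum plaqDefectSqSum
  have h := sq_sum_le_card_mul_sum_sq (s := Finset.range m ×ˢ Finset.range (b + 1))
    (f := fun p : ℕ × ℕ => ‖ρ (plaq U p.2 p.1) - 1‖)
  rw [Finset.sum_product, Finset.sum_product, Finset.card_product, Finset.card_range,
    Finset.card_range] at h
  push_cast at h ⊢
  linarith

omit [TopologicalSpace G] [IsTopologicalGroup G] [CompactSpace G] [SecondCountableTopology G] [MeasurableSpace G]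
  [BorelSpace G] in
/-- Helper lemma `plaqDefectSum_le_sqrt` of the row-floor chain (re-homed verbatim from the crux workfile; see the module docstring). -/
theorem plaqDefectSum_le_sqrt (b m : ℕ) (U : LGConfig 4 G) :
    plaqDefectSum ρ b m U ≤ Real.sqrt (((b + 1 : ℕ) * m : ℝ) * plaqDefectSqSum ρ b m U) :=
  (le_abs_self _).trans (Real.abs_le_sqrt (plaqDefectSum_sq_le ρ b m U))

/-- The kernel mean of the film's plaquette ENERGY on `Σ` with the twisted boundary:
`E_{γ_Λ(·|σ')} Σ_{p∈Σ} ‖ρ(U_p) − 1‖²_F`, `σ' = topTwist(comb)(torusLift V)`. -/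
def kernelPlaqDefectSq (β : ℝ) (b n : ℕ) (k₀ : G) (V : GaugeConfig 4 (2 * ((2 * n + 2) * b + 1) + 1) G) : ℝ :=
  ∫ U, plaqDefectSqSum ρ b ((2 * n + 1) * b) U
    ∂(ymSpecification ρ β (rowRegion b n)
      (twistΦ b (comb b ((2 * n + 2) * b + 1) k₀) (torusLift (2 * ((2 * n + 2) * b + 1) + 1) V)))

omit [SecondCountableTopology G] in
/-- Helper lemma `kernelPlaqDefectSq_nonneg` of the row-floor chain (re-homed verbatim from the crux workfile; see the module docstring). -/
theorem kernelPlaqDefectSq_nonneg (β : ℝ) (b n : ℕ) (k₀ : G) (V : GaugeConfig 4 (2 * ((2 * n + 2) * b + 1) + 1) G) :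
    0 ≤ kernelPlaqDefectSq ρ β b n k₀ V :=
  integral_nonneg fun U => plaqDefectSqSum_nonneg ρ _ _ U

/-- `V ↦ kernelPlaqDefectSq V` is continuous (as `continuous_kernelPlaqDefect`). -/
theorem continuous_kernelPlaqDefectSq (hρ : Continuous ρ) (hρu : ∀ g, ρ g ∈ Matrix.unitaryGroup (Fin N) ℂ) (β : ℝ)
    (b n : ℕ) (k₀ : G) : Continuous (kernelPlaqDefectSq ρ β b n k₀) := by
  have hker := continuous_integral_ymSpecification ρ hρ β (rowRegion b n)
    (continuous_plaqDefectSqSum ρ hρ b ((2 * n + 1) * b))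
    (C := ((2 * n + 1) * b : ℕ) * ((b + 1) * (2 * Real.sqrt N) ^ 2))
    (fun U => by rw [abs_of_nonneg (plaqDefectSqSum_nonneg ρ _ _ U)]; exact plaqDefectSqSum_le ρ hρu _ _ U)
  have hbd : Continuous fun V : GaugeConfig 4 (2 * ((2 * n + 2) * b + 1) + 1) G =>
      twistΦ b (comb b ((2 * n + 2) * b + 1) k₀) (torusLift (2 * ((2 * n + 2) * b + 1) + 1) V) :=
    (continuous_twist_comb b _ k₀).comp (continuous_torusLift _)
  exact hker.comp hbd

/-- **K1′ ⇐ K1″ pointwise (PROVED):** `kernelPlaqDefect V ≤ √(#Σ · kernelPlaqDefectSq V)` (Cauchy–Schwarz under the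
kernel, then Jensen for `√`). -/
theorem kernelPlaqDefect_le_sqrt (hρ : Continuous ρ) (β : ℝ)
    (b n : ℕ) (k₀ : G) (V : GaugeConfig 4 (2 * ((2 * n + 2) * b + 1) + 1) G) :
    kernelPlaqDefect ρ β b n k₀ V ≤
      Real.sqrt (((b + 1 : ℕ) * ((2 * n + 1) * b : ℕ) : ℝ) * kernelPlaqDefectSq ρ β b n k₀ V) := by
  unfold kernelPlaqDefect kernelPlaqDefectSq
  set γ := ymSpecification ρ β (rowRegion b n)
    (twistΦ b (comb b ((2 * n + 2) * b + 1) k₀) (torusLift (2 * ((2 * n + 2) * b + 1) + 1) V)) with hγ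
  haveI : IsProbabilityMeasure γ := isProbabilityMeasure_ymSpecification ρ hρ β _ _
  set M : ℝ := ((b + 1 : ℕ) * ((2 * n + 1) * b : ℕ) : ℝ) with hM
  have hM0 : 0 ≤ M := by positivity
  have hc2 := continuous_plaqDefectSqSum ρ hρ b ((2 * n + 1) * b)
  calc ∫ U, plaqDefectSum ρ b ((2 * n + 1) * b) U ∂γ
      ≤ ∫ U, Real.sqrt (M * plaqDefectSqSum ρ b ((2 * n + 1) * b) U) ∂γ :=
        integral_mono (integrable_of_continuous γ (continuous_plaqDefectSum ρ hρ _ _))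
          (integrable_of_continuous γ (Real.continuous_sqrt.comp (continuous_const.mul hc2)))
          fun U => plaqDefectSum_le_sqrt ρ _ _ U
    _ ≤ Real.sqrt (∫ U, M * plaqDefectSqSum ρ b ((2 * n + 1) * b) U ∂γ) :=
        integral_sqrt_le_sqrt_integral γ (fun U => mul_nonneg hM0 (plaqDefectSqSum_nonneg ρ _ _ U))
          (integrable_of_continuous γ (continuous_const.mul hc2))
    _ = Real.sqrt (M * ∫ U, plaqDefectSqSum ρ b ((2 * n + 1) * b) U ∂γ) := by rw [integral_const_mul]

/-- **K1′ ⇐ K1″ under `μ` (PROVED):** `E_μ kernelPlaqDefect ≤ √(#Σ · E_μ kernelPlaqDefectSq)` (Jensen for `√` again). -/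
theorem integral_kernelPlaqDefect_le_sqrt (hρ : Continuous ρ) (hρu : ∀ g, ρ g ∈ Matrix.unitaryGroup (Fin N) ℂ)
    (β : ℝ) (b n : ℕ) (k₀ : G) :
    ∫ V, kernelPlaqDefect ρ β b n k₀ V ∂(wilsonMeasure (d := 4) (L := 2 * ((2 * n + 2) * b + 1) + 1) ρ β) ≤
      Real.sqrt (((b + 1 : ℕ) * ((2 * n + 1) * b : ℕ) : ℝ) *
        ∫ V, kernelPlaqDefectSq ρ β b n k₀ V ∂(wilsonMeasure (d := 4) (L := 2 * ((2 * n + 2) * b + 1) + 1) ρ β)) := by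
  set μ := wilsonMeasure (d := 4) (L := 2 * ((2 * n + 2) * b + 1) + 1) ρ β with hμ
  haveI : IsProbabilityMeasure μ := isProbabilityMeasure_wilsonMeasure ρ hρ β
  set M : ℝ := ((b + 1 : ℕ) * ((2 * n + 1) * b : ℕ) : ℝ) with hM
  have hM0 : 0 ≤ M := by positivity
  have hc1 := continuous_kernelPlaqDefect ρ hρ hρu β b n k₀
  have hc2 := continuous_kernelPlaqDefectSq ρ hρ hρu β b n k₀
  calc ∫ V, kernelPlaqDefect ρ β b n k₀ V ∂μ ≤ ∫ V, Real.sqrt (M * kernelPlaqDefectSq ρ β b n k₀ V) ∂μ :=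
        integral_mono (integrable_of_continuous μ hc1)
          (integrable_of_continuous μ (Real.continuous_sqrt.comp (continuous_const.mul hc2)))
          fun V => kernelPlaqDefect_le_sqrt ρ hρ β b n k₀ V
    _ ≤ Real.sqrt (∫ V, M * kernelPlaqDefectSq ρ β b n k₀ V ∂μ) :=
        integral_sqrt_le_sqrt_integral μ (fun V => mul_nonneg hM0 (kernelPlaqDefectSq_nonneg ρ β b n k₀ V))
          (integrable_of_continuous μ (continuous_const.mul hc2))
    _ = Real.sqrt (M * ∫ V, kernelPlaqDefectSq ρ β b n k₀ V ∂μ) := by rw [integral_const_mul]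

/-- **K1′ ⇐ K1″ with the rates (PROVED):** a LINEAR plaquette-energy bound `E_μ E_γ Σ_Σ ‖ρ(U_p) − 1‖² ≤ C b⁵ log β/β`
gives the defect bound `E_μ E_γ Σ_Σ ‖ρ(U_p) − 1‖ ≤ √(2(2n+1)C) · b^{7/2} √(log β/β)` (`#Σ = (b+1)(2n+1)b ≤ 2(2n+1)b²`). -/
theorem integral_kernelPlaqDefect_le_of_sq (hρ : Continuous ρ) (hρu : ∀ g, ρ g ∈ Matrix.unitaryGroup (Fin N) ℂ)
    {n : ℕ} {k₀ : G}
    (h : ∃ C : ℝ, 0 < C ∧ ∃ β₁ : ℝ, ∀ β : ℝ, β₁ ≤ β → ∀ b : ℕ, 1 ≤ b →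
      ∫ V, kernelPlaqDefectSq ρ β b n k₀ V ∂(wilsonMeasure (d := 4) (L := 2 * ((2 * n + 2) * b + 1) + 1) ρ β) ≤
        C * (b : ℝ) ^ 5 * (Real.log β / β)) :
    ∃ C : ℝ, 0 < C ∧ ∃ β₁ : ℝ, ∀ β : ℝ, β₁ ≤ β → ∀ b : ℕ, 1 ≤ b →
      ∫ V, kernelPlaqDefect ρ β b n k₀ V ∂(wilsonMeasure (d := 4) (L := 2 * ((2 * n + 2) * b + 1) + 1) ρ β) ≤
        C * (b : ℝ) ^ (7 / 2 : ℝ) * Real.sqrt (Real.log β / β) := by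
  obtain ⟨C, hC, β₁, h⟩ := h
  have h2C : 0 < 2 * (2 * (n : ℝ) + 1) * C := by positivity
  set K : ℝ := Real.sqrt (2 * (2 * (n : ℝ) + 1) * C) with hK
  have hK0 : 0 < K := Real.sqrt_pos.2 h2C
  refine ⟨K, hK0, max β₁ 1, fun β hβ b hb => ?_⟩
  have hβ1 : β₁ ≤ β := (le_max_left _ _).trans hβ
  have hβone : (1 : ℝ) ≤ β := (le_max_right _ _).trans hβ
  have hL0 : 0 ≤ Real.log β / β := div_nonneg (Real.log_nonneg hβone) (by linarith)
  have hb0 : (0 : ℝ) ≤ b := Nat.cast_nonneg _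
  have hb1 : (1 : ℝ) ≤ b := by exact_mod_cast hb
  set μ := wilsonMeasure (d := 4) (L := 2 * ((2 * n + 2) * b + 1) + 1) ρ β with hμ
  set X := ∫ V, kernelPlaqDefectSq ρ β b n k₀ V ∂μ with hX
  have hXle : X ≤ C * (b : ℝ) ^ 5 * (Real.log β / β) := h β hβ1 b hb
  have hX0 : 0 ≤ X := integral_nonneg fun V => kernelPlaqDefectSq_nonneg ρ β b n k₀ V
  set M : ℝ := ((b + 1 : ℕ) * ((2 * n + 1) * b : ℕ) : ℝ) with hM
  have hMle : M ≤ 2 * (2 * (n : ℝ) + 1) * (b : ℝ) ^ 2 := by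
    rw [hM]; push_cast
    nlinarith [mul_nonneg (show (0 : ℝ) ≤ 2 * n + 1 by positivity) hb0, hb1]
  have hstep : ∫ V, kernelPlaqDefect ρ β b n k₀ V ∂μ ≤ Real.sqrt (M * X) :=
    integral_kernelPlaqDefect_le_sqrt ρ hρ hρu β b n k₀
  have h7 : ((b : ℝ) ^ (7 / 2 : ℝ)) ^ 2 = (b : ℝ) ^ 7 := by
    rw [← Real.rpow_natCast _ 2, ← Real.rpow_natCast _ 7, ← Real.rpow_mul hb0]; norm_num
  have hKsq : K ^ 2 = 2 * (2 * (n : ℝ) + 1) * C := Real.sq_sqrt h2C.le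
  have hprod : M * X ≤ (K * (b : ℝ) ^ (7 / 2 : ℝ)) ^ 2 * (Real.log β / β) := by
    calc M * X ≤ (2 * (2 * (n : ℝ) + 1) * (b : ℝ) ^ 2) * (C * (b : ℝ) ^ 5 * (Real.log β / β)) :=
          mul_le_mul hMle hXle hX0 (by positivity)
      _ = (K * (b : ℝ) ^ (7 / 2 : ℝ)) ^ 2 * (Real.log β / β) := by rw [mul_pow, hKsq, h7]; ring
  have hKb : 0 ≤ K * (b : ℝ) ^ (7 / 2 : ℝ) := mul_nonneg hK0.le (Real.rpow_nonneg hb0 _)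
  calc ∫ V, kernelPlaqDefect ρ β b n k₀ V ∂μ ≤ Real.sqrt (M * X) := hstep
    _ ≤ Real.sqrt ((K * (b : ℝ) ^ (7 / 2 : ℝ)) ^ 2 * (Real.log β / β)) := Real.sqrt_le_sqrt hprod
    _ = K * (b : ℝ) ^ (7 / 2 : ℝ) * Real.sqrt (Real.log β / β) := by
        rw [Real.sqrt_mul (sq_nonneg _), Real.sqrt_sq hKb]

end PlaqEnergy

end Summit.QuantumFields.YangMills.Cruxes.IR.RowFloorPoly

end
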